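import Literature.MathematicalPhysics.QuantumFieldTheory.Balaban1983to89.B8Eq156Prop4

/-!
# `Balaban1983to89.B8Prop3Concrete` — T. Bałaban, *Spaces of regular gauge field configurations on a lattice and gauge
# fixing conditions*, Commun. Math. Phys. **99** (1985) 75–102 [Balaban1985RegularSpaces], **Proposition 3** (p. 87):
# «(1.40)–(1.42) with α₀, α₁, α₂ bounded by a constant depending on d and L only, and (1.61) ⇒ (1.62) with B₁ = 5dLB₀»
# ON THE CONCRETE `ℤᵈ` CARRIERS of the B7/B8 lineage, the Theorem-3.3-of-[4] bounds (1.59) being the explicit inputs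

statement-level skeleton of published theorems with citation tags; proofs where landed; nothing here is a claim about the Yang–Mills mass gap

PDF held: `paper:balaban1985-cmp99-regular-spaces-gauge-fixing` (journal page = PDF page + 74); pages read for this module AS
IMAGE: render `run/shared/lean/pub/pub-balaban/b2b-balaban-ref1/pages/1985-cmp99-regular-spaces-gauge-fixing/…-p012-x2.png`
(p. 86, (1.55)–(1.61)) and the materialised text of p. 87 (Proposition 3, (1.62)); [3] = [Balaban1985Averaging], [4] =
[Balaban1985BackgroundPropagators].

CITATION HEADER (lean-in-tree rule).  Cell `lit-balaban` (HOME `run/shared/lean/pub/lit-balaban/`), unit `lit-balaban-p40`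
gen 6 (Phase-2 proof seat p40; B8 fold owner r05, referee ref-4; free-target protocol G.5-34(d), TAKING HOME/STATUS
2026-08-21T09:42:59Z).  WHAT IS REPRODUCED = SKELETON row **`B8.Prop3`** (Proposition 3 p. 87; cell status «typed-existing
(abstract carrier)», decl of record `B8.Prop3Printed` = `∃ c > 0, B8.Prop3Body c …` over `fam : I → B8.GFData2`): the
proposition's implication PROVED for the concrete objects of the tree at one level `j` — hypotheses (1.40)–(1.42) and
(1.61) on a unitary-valued background `U₀ : ℤᵈ-bonds → U(𝔸)` and a Hermitian `A` (`U₁ = e^{iηA}`), conclusion (1.62) = the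
(1.36)/(1.39)-bounds with the printed constant `B₁ = 5dLB₀` — by composing, exactly as printed on pp. 86–87, the tree's
kernel theorems for the steps of Sect. C: (1.43)–(1.55) (`B8Eq155JBound.eq155_norm`, lineage pv/b08), (1.56) ([3] Prop. 4
at a general background, `B8Eq156Prop4.wsup_B1_le`, p40 g3 on p06's `B7Eq123General.prop4_general`), the bootstrap
(1.59) ⇒ (1.60) (`B8.apriori_160` via `B8Eq156Prop4.apriori_160_of_156_unitary`) and (1.60) + (1.61) ⇒ (1.62)
(`B8.apriori_162`).  The one input the paper takes from [4] — «Theorem 3.3 of [4] implies the bounds (1.59)» (row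
`B8.Eq1.59`, the cell's interface need I-B8-2: the operators `G(U₀)`, `H(U₀)` are not concrete in the tree) — enters as the
four displayed real hypotheses `h59a h59g h59j h59l`, by name and unchanged from the tree's (1.59)/(1.60) theorems; nothing
else is assumed: «α₀, α₁, α₂ bounded by a constant depending on d and L only» is an EXPLICIT threshold `c(d, L, B₀) > 0`
(`prop3_concrete`; `B₀` «depends on d and L only», p. 87), and (1.61) is taken with the `α₀`-free constant
`C₂ = C₂(d) = 16·C₁(d) = 2097152(d+1)²` majorising the tree's `C₂(d, α₀) = 8C₁e^{4cα₀}` of (1.56) on the admissible range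
(`e^{4cα₀} ≤ 2`).  Kind «kernel-checked proof», theorems only; no `… : Prop` fact, no definition; no existing module is
modified; REUSED BY NAME: `B8Eq156Prop4.apriori_160_of_156_unitary`, `B8.apriori_162`, `B8Eq155JBound.wsup/le_wsup/jNorm3/
gradNorm2/norm_covDerivFwd_le_gradNorm2`, `B7Prop2Explicit.pdev/C0/c2'/unitaryUnits`, `B7Prop3Flat.c3`,
`B7Prop4GeneralLevels.logCovIter/linCovIter`, `B8Eq146AExpansion.iEta/expCfg`, `B8Ineq132.covDiv/covDerivFwd`,
`B8Lemma1NonAbelian.mulCfg`.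

WHAT IS PRINTED (pp. 86–87 [PDF 12–13], verbatim from the render / the materialised text).  p. 86: *"Theorem 3.3 of [4]
implies the bounds: |A|_(−1), |∇^η_{U₀}A|_(−2), |D^{η*}_{U₀}D^η_{U₀}A|_(−3), |Δ^η_{U₀}A|_(−3) ≦ B₀(|J|_(−3) + |B₁|) ≦ B₀(2α₀ +
36dα₂|∇^η_{U₀}A|_(−2) + 50dα₂³ + 10dα₀α₂ + 2dLα₁ + C₂α₂²). (1.59) Let us take this bound for |∇^η_{U₀}A|_(−2) on the left-hand
side, and let us assume that B₀36dα₂ ≦ 1/2. … (1.60) Now we assume further that 2α₂² + 20dα₀α₂ + 2C₂α₂² ≦ α₀ + α₁. (1.61)"*;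
p. 87: *"This and the previous inequality give finally |A| < 5dLB₀(α₀ + α₁)(Lʲη)⁻¹, |∇^η_{U₀}A| < 5dLB₀(α₀ + α₁)(Lʲη)⁻²,
‖A‖_{1,β} < 5dLB₀(β)(α₀ + α₁)(Lʲη)^{−2−β}, |D^{η*}_{U₀}D^η_{U₀}A|, |Δ^η_{U₀}A| < 5dLB₀(α₀ + α₁)(Lʲη)⁻³ on Ω_j. (1.62)  Let us
formulate the results in **Proposition 3.** If U₀, U₁U₀ satisfy (1.40)–(1.42) with α₀, α₁, α₂ bounded by a constant
depending on d and L only, and α₂ satisfies the additional restriction (1.61), then U₁ satisfies (1.36)–(1.39) with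
B₁ = 5dLB₀, B₂(β₀) = 5dLB₀(β₀), where B₀, B₀(β₀) are the corresponding norms of the operators G(U₀), H(U₀), and depend on d
and L only, B₀(β₀) on β₀ also."*; the hypotheses (p. 83 [PDF 9]): *"U₀, U₁U₀ ∈ 𝔄_k({Ω_j}, α₀), U₀ satisfies the additional
regularity condition (3.35) in [4], (1.40) U₁ = e^{iηA}, |A| < α₂(Lʲη)⁻¹ on Ω_j, (1.41) R(U₀)D^{η*}_{U₀}A = 0, Q_j(U₀, ηA) = B on
Λ_j, |B| < 2dLα₁, (1.42)"*.

DICTIONARY (the `ℤᵈ` model of the parent lineages; nothing new — see `B8Eq156Prop4`'s header).  Sites `Site d = Fin d → ℤ`,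
bond fields `A : Site d → Fin d → 𝔸` over a non-trivial C⋆-algebra `𝔸` (print: `M_N(ℂ) ⊃ U(N) ⊃ G`, `A` `𝔤`-valued ↦
`IsSelfAdjoint (A y κ)`), `U₀` with values in the unitary group `B7Prop2Explicit.unitaryUnits 𝔸`; `U₁ = e^{iηA}` ↦
`expCfg (iEta η A)`, `U₁U₀` ↦ `mulCfg (expCfg (iEta η A)) U₀`.  (1.40) at the level `j` (lineage GLOBAL reading, HONEST
SCOPE (i)): plaquettes of `U₀` `pdev U₀ < α₀(Lʲ)⁻²` (= (1.8)), and the (1.9)-members for `U₀` and `U₁U₀`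
`|D^{η*}∂(·)_μ(x)| ≤ α₀η²(Lʲη)⁻³` (`h40₀`, `h40₁`); (1.41) ↦ `‖A y κ‖ ≤ α₂(Lʲη)⁻¹`; (1.42), second clause, «on Λ_j» ↦ a set
`S` of bonds `(z, κ)` of the `j`-lattice with `‖Q_j(U₀, ηA)(z, κ)‖ < 2dLα₁` there (`Q_j(U₀, ηA)` =
`B7Prop4GeneralLevels.logCovIter`, `B₁ = LʲηQ_jA` = `linCovIter`, `|B₁|` = `wsup 1` over `S`, as in `B8Eq156Prop4`); the
level-`j` global norms of p. 86: `|A|_(−1)` ↦ `wsup (Lʲη) (fun (y, κ) ↦ A y κ)`, `|∇^η_{U₀}A|_(−2)` ↦ `B8Eq155JBound.gradNorm2`,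
`|J|_(−3) = |D^{η*}_{U₀}D^η_{U₀}A|_(−3)` ↦ `B8Eq155JBound.jNorm3`; `|Δ^η_{U₀}A|_(−3)` (the covariant LAPLACIAN of [4] (3.10), with
its curvature part — not a concrete object of the lineage) ↦ a real `l`, exactly as in `B8.apriori_160`; likewise the third
entry is carried as a real `j₂` (print's `|D^{η*}D^ηA|_(−3)`; for `B₀ ≥ 1` one may take `j₂ = |J|_(−3)` itself,
`third_entry_of_one_le`).

WHAT THIS FILE PROVES (kernel, no `sorry`, axioms ⊆ {propext, Classical.choice, Quot.sound}).
* **`prop3_norms_of_small`** — the norm form of (1.62): under (1.40)–(1.42) as above, the displayed smallness conditions on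
  `α₀, α₂` (those of the inputs: [3] Prop. 2/Prop. 4 windows, «B₀36dα₂ ≦ 1/2», `50dα₂ ≤ 1`, `16α₂ ≤ 1`), (1.61)
  with `C₂(d)`, and the four (1.59) bounds: `|A|_(−1), |∇^η_{U₀}A|_(−2), j₂, l ≤ 5dLB₀(α₀ + α₁)`.
* **`prop3_pointwise_of_small`** — the printed pointwise form of (1.62) at every bond: `‖A y κ‖ ≤ 5dLB₀(α₀+α₁)(Lʲη)⁻¹`,
  `‖(D^η_{U₀,κ}A_τ)(y)‖ ≤ 5dLB₀(α₀+α₁)(Lʲη)⁻²` (+ the two carried reals).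
* **`prop3_concrete`** — **Proposition 3** in print's quantifier shape: `∃ c = c(d, L, B₀) > 0` such that for all
  `0 < α₀, α₁, α₂ ≤ c` with (1.61), every unitary `U₀` and Hermitian `A` satisfying (1.40)–(1.42) at the level `j` and the
  (1.59) bounds obey (1.62) (norm and pointwise forms) with `B₁ = 5dLB₀`.
* `third_entry_of_one_le` — the third (1.59) entry is (1.55)'s definition `J = D^{η*}D^ηA` when `B₀ ≥ 1` (cf.
  `B8FromB9.b8_159_DstarD_entry`); private arithmetic `exp_window`/`C2_le_of_window` ([3]-Prop.-4 window, `C₂(d, α₀) ≤ C₂(d)`).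

HONEST SCOPE.  (i) One level `j`, (1.40)/(1.41) read GLOBALLY on `ℤᵈ` (the lineage convention of `B8Eq155JBound`/
`B8Eq156Prop4`; print's multi-level «on Ω_j» localisation of Sect. C is the cell's G-adv8-11/G-B8-16 reading issue and is
not re-examined here).  (ii) The Hölder member `‖A‖_{1,β} < 5dLB₀(β)(α₀+α₁)(Lʲη)^{−2−β}` of (1.62)/(1.36) is NOT modelled
(interface need I-B8-3: no concrete Hölder seminorm on these carriers), nor is `B₂(β₀)`.  (iii) The (1.59) bounds are
HYPOTHESES (row `B8.Eq1.59`; [4] Thm 3.3 + (1.57)–(1.58)); consequently the Landau clause `R(U₀)D^{η*}_{U₀}A = 0` of (1.42)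
and «(3.35) of [4]» of (1.40), which print uses only inside (1.57)–(1.59), do not appear among the hypotheses below —
they are consumed by whoever discharges `h59*`.  (iv) Conclusions are `≤` where print has `<` (as in the tree's (1.60)).
(v) `C₂` of (1.61) is the explicit `C₂(d) = 2097152(d+1)²` ≥ the tree's (1.56)-constant on the admissible range; print's
`C₂` is «the constant of Prop. 4 of [3], depends on d».  Value = the row's printed one-page argument assembled end to end on
the concrete carriers, modulo the named [4]-leaf; NOT summit progress.
-/

namespace Literature.MathematicalPhysics.QuantumFieldTheory.Balaban1983to89.B8Prop3Concrete

-- bare `Site d` must be the `ℤᵈ` carrier `B7Prop1Explicit.Site`, not the torus `Balaban1983to89.Site` of `Setup`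
export B7Prop1Explicit (Site)
open B7Prop1Explicit (U1)
open B7Prop2Explicit (pdev C0 c2' unitaryUnits unitaryUnits_le_U1 C0_pos)
open B7Prop3Flat (c3)
open B7Prop4GeneralLevels (logCovIter linCovIter)
open B8Lemma1NonAbelian (mulCfg)
open B8Ineq132 (covDiv covDerivFwd)
open B8Eq146AExpansion (iEta expCfg)
open B8Eq155JBound (wsup wsup_le le_wsup wsup_nonneg jNorm3 gradNorm2 jNorm3_nonneg gradNorm2_nonneg
  norm_covDerivFwd_le_gradNorm2)
open B8Eq156Prop4 (apriori_160_of_156_unitary)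

/-! ## §1 Arithmetic of the windows -/

/-- The [3]-Prop.-4 window in the `α₀`-free form used for `C₂(d)`: `4cα₀ ≤ 1/10` and `8C₁α₂ ≤ 1/2` give
`e^{4cα₀}(1 + 8C₁α₂) ≤ 2` (`e^{1/10} ≤ 6/5`). [folklore] -/
private theorem exp_window {x y : ℝ} (hx0 : 0 ≤ x) (hx : x ≤ 1 / 10) (hy0 : 0 ≤ y) (hy : y ≤ 1 / 2) :
    Real.exp x * (1 + y) ≤ 2 := by
  have h := Real.abs_exp_sub_one_le (x := x) (by rw [abs_of_nonneg hx0]; linarith)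
  rw [abs_of_nonneg hx0] at h
  have h2 : Real.exp x ≤ 1 + 2 * x := by linarith [(abs_le.mp h).2]
  have h3 : Real.exp x ≤ 6 / 5 := by linarith
  calc Real.exp x * (1 + y) ≤ 6 / 5 * (1 + 1 / 2) := by
        gcongr
    _ ≤ 2 := by norm_num

/-- From the window `e^{4cα₀}(1 + 8C₁α₂) ≤ 2` alone: `e^{4cα₀} ≤ 2`, hence the (1.56)-constant `C₂(d, α₀) = 8C₁e^{4cα₀}` is
majorised by the `α₀`-free `C₂(d) = 16C₁`. [folklore] -/
private theorem C2_le_of_window {d : ℕ} {α₀ α₂ : ℝ} (hα₂ : 0 ≤ α₂)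
    (hsmall : Real.exp (4 * (800 * ((d : ℝ) + 1) ^ 2 * ((d : ℝ) + 4)) * α₀)
      * (1 + 8 * (131072 * ((d : ℝ) + 1) ^ 2) * α₂) ≤ 2) :
    8 * (131072 * ((d : ℝ) + 1) ^ 2) * Real.exp (4 * (800 * ((d : ℝ) + 1) ^ 2 * ((d : ℝ) + 4)) * α₀)
      ≤ 2097152 * ((d : ℝ) + 1) ^ 2 := by
  set E := Real.exp (4 * (800 * ((d : ℝ) + 1) ^ 2 * ((d : ℝ) + 4)) * α₀) with hE
  have hE0 : 0 < E := Real.exp_pos _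
  have hy : 0 ≤ 8 * (131072 * ((d : ℝ) + 1) ^ 2) * α₂ := by positivity
  have hE2 : E ≤ 2 := by nlinarith
  have hK : 0 ≤ 8 * (131072 * ((d : ℝ) + 1) ^ 2) := by positivity
  calc 8 * (131072 * ((d : ℝ) + 1) ^ 2) * E ≤ 8 * (131072 * ((d : ℝ) + 1) ^ 2) * 2 :=
        mul_le_mul_of_nonneg_left hE2 hK
    _ = 2097152 * ((d : ℝ) + 1) ^ 2 := by ring

/-- The third entry of (1.59), `|D^{η*}_{U₀}D^η_{U₀}A|_(−3) ≦ B₀(|J|_(−3) + |B₁|)`, is (1.55)'s definition `J = D^{η*}D^ηA`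
as soon as `B₀ ≥ 1` (and `|B₁| ≥ 0`): with `j₂ = |J|_(−3)` the hypothesis `h59j` below holds (cf. the abstract
`B8FromB9.b8_159_DstarD_entry`). [cite: Balaban1985RegularSpaces, (1.55) + (1.59) p.86] -/
theorem third_entry_of_one_le {B₀ nJ nB : ℝ} (hB₀ : 1 ≤ B₀) (hJ : 0 ≤ nJ) (hB : 0 ≤ nB) :
    nJ ≤ B₀ * (nJ + nB) := by nlinarith

variable {d : ℕ} {𝔸 : Type*} [CStarAlgebra 𝔸] [Nontrivial 𝔸]

/-! ## §2 (1.62) in norm form and pointwise, under displayed smallness conditions -/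

/-- **(1.40)–(1.42) + (1.61) ⇒ (1.62), NORM FORM** (Sect. C pp. 86–87 assembled; one level `j`, global reading).
Hypotheses: `U₀` unitary-valued with (1.40) at the level `j` (`h40` plaquettes = (1.8), `h40₀`/`h40₁` = (1.9) for `U₀` and
`U₁U₀`), `A` Hermitian with (1.41) (`h41`), (1.42) second clause on the bond set `S` of `Λ_j` (`h42`), the smallness of
`α₀, α₂` displayed (`hα3 … h50`), the restriction (1.61) with `C₂(d) = 2097152(d+1)²` (`h61`), and the four bounds (1.59)
of Theorem 3.3 of [4] (`h59a h59g h59j h59l`, with `|A|_(−1) = wsup (Lʲη) A`, `|∇A|_(−2) = gradNorm2`, `|J|_(−3) = jNorm3`,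
`|B₁| = wsup 1 (LʲηQ_jA)` over `S`, and reals `j₂`, `l` for the third and fourth entries).  Conclusion (1.62) with
`B₁ = 5dLB₀`: `|A|_(−1), |∇^η_{U₀}A|_(−2), j₂, l ≤ 5dLB₀(α₀ + α₁)`. [cite: Balaban1985RegularSpaces, Prop. 3 (1.62) p.87; (1.59)–(1.61) p.86] -/
theorem prop3_norms_of_small (hd : 1 ≤ d) {η : ℝ} (hη : 0 < η) {L : ℕ} (hL : 2 ≤ L) {j : ℕ}
    {U₀ : Site d → Fin d → 𝔸ˣ} (hU₀ : ∀ y κ, U₀ y κ ∈ unitaryUnits 𝔸)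
    {A : Site d → Fin d → 𝔸} (hAh : ∀ y κ, IsSelfAdjoint (A y κ)) {α₀ α₁ α₂ : ℝ}
    (hα₀ : 0 < α₀) (hα₁ : 0 ≤ α₁) (hα₂ : 0 ≤ α₂)
    (hα3 : C0 d * α₀ ≤ 1 / 3) (hα4 : 4 * α₀ ≤ c2' d L) (h16 : 16 * α₂ ≤ 1)
    (hsmall : Real.exp (4 * (800 * ((d : ℝ) + 1) ^ 2 * ((d : ℝ) + 4)) * α₀)
      * (1 + 8 * (131072 * ((d : ℝ) + 1) ^ 2) * α₂) ≤ 2)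
    (hc₃ : 2 * α₂ ≤ c3 d L) {B₀ : ℝ} (hB₀ : 0 ≤ B₀) (hside : 36 * d * B₀ * α₂ ≤ 1 / 2) (h50 : 50 * d * α₂ ≤ 1)
    (h61 : 2 * α₂ ^ 2 + 20 * d * α₀ * α₂ + 2 * (2097152 * ((d : ℝ) + 1) ^ 2) * α₂ ^ 2 ≤ α₀ + α₁)
    (h40 : pdev U₀ < α₀ * (((L : ℝ) ^ j)⁻¹) ^ 2)
    (h40₀ : ∀ (μ : Fin d) (x : Site d), ‖covDiv η U₀ μ x‖ ≤ α₀ * η ^ 2 * (((L : ℝ) ^ j * η)⁻¹) ^ 3)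
    (h40₁ : ∀ (μ : Fin d) (x : Site d),
      ‖covDiv η (mulCfg (expCfg (iEta η A)) U₀) μ x‖ ≤ α₀ * η ^ 2 * (((L : ℝ) ^ j * η)⁻¹) ^ 3)
    (h41 : ∀ y κ, ‖A y κ‖ ≤ α₂ * ((L : ℝ) ^ j * η)⁻¹)
    (S : Set (Site d × Fin d)) (h42 : ∀ b ∈ S, ‖logCovIter L U₀ (iEta η A) j b.1 b.2‖ < 2 * d * L * α₁)
    {j₂ l : ℝ}
    (h59a : wsup ((L : ℝ) ^ j * η) (fun p : Site d × Fin d => A p.1 p.2)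
      ≤ B₀ * (jNorm3 η L j U₀ A + wsup 1 (fun b : S => linCovIter L U₀ (iEta η A) j b.1.1 b.1.2)))
    (h59g : gradNorm2 η L j U₀ A
      ≤ B₀ * (jNorm3 η L j U₀ A + wsup 1 (fun b : S => linCovIter L U₀ (iEta η A) j b.1.1 b.1.2)))
    (h59j : j₂ ≤ B₀ * (jNorm3 η L j U₀ A + wsup 1 (fun b : S => linCovIter L U₀ (iEta η A) j b.1.1 b.1.2)))
    (h59l : l ≤ B₀ * (jNorm3 η L j U₀ A + wsup 1 (fun b : S => linCovIter L U₀ (iEta η A) j b.1.1 b.1.2))) :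
    wsup ((L : ℝ) ^ j * η) (fun p : Site d × Fin d => A p.1 p.2) ≤ 5 * d * L * B₀ * (α₀ + α₁) ∧
    gradNorm2 η L j U₀ A ≤ 5 * d * L * B₀ * (α₀ + α₁) ∧
    j₂ ≤ 5 * d * L * B₀ * (α₀ + α₁) ∧ l ≤ 5 * d * L * B₀ * (α₀ + α₁) := by
  have hL1 : (1 : ℝ) ≤ L := by exact_mod_cast (le_trans (by norm_num) hL)
  have hLj : (1 : ℝ) ≤ (L : ℝ) ^ j := one_le_pow₀ hL1
  have hLj0 : (0 : ℝ) < (L : ℝ) ^ j := by positivity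
  -- `α₂(Lʲη)⁻¹η = α₂/Lʲ ≤ α₂`
  have hresc : α₂ * ((L : ℝ) ^ j * η)⁻¹ * η = α₂ * ((L : ℝ) ^ j)⁻¹ := by
    field_simp
  have hle : α₂ * ((L : ℝ) ^ j * η)⁻¹ * η ≤ α₂ := by
    rw [hresc]
    have : ((L : ℝ) ^ j)⁻¹ ≤ 1 := inv_le_one_of_one_le₀ hLj
    calc α₂ * ((L : ℝ) ^ j)⁻¹ ≤ α₂ * 1 := mul_le_mul_of_nonneg_left this hα₂
      _ = α₂ := mul_one _
  have hsmall16 : 16 * (α₂ * ((L : ℝ) ^ j * η)⁻¹ * η) ≤ 1 := by linarith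
  have hd1 : (0 : ℝ) ≤ (d : ℝ) - 1 := by
    have : (1 : ℝ) ≤ d := by exact_mod_cast hd
    linarith
  -- `5α₂(d − 1)/Lʲ ≤ 5dα₂ ≤ 1/10 ≤ 4` (from `50dα₂ ≤ 1`)
  have hd5' : 5 * (α₂ * ((L : ℝ) ^ j * η)⁻¹ * η) * ((d : ℝ) - 1) ≤ 4 := by
    have h1 := mul_le_mul_of_nonneg_right (mul_le_mul_of_nonneg_left hle (by norm_num : (0 : ℝ) ≤ 5)) hd1
    have h2 : 5 * α₂ * ((d : ℝ) - 1) ≤ 4 := by nlinarith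
    linarith
  -- the bootstrap (1.55) + (1.56) + (1.59) ⇒ (1.60), with `C₂(d, α₀)`
  obtain ⟨ha, hg, hj, hl⟩ := apriori_160_of_156_unitary hη hL hU₀ hAh hα₀ hα₁ hα₂ hα3 hα4 h40 h41 hsmall16 hd5'
    h40₁ h40₀ hsmall hc₃ (Subtype.val : S → Site d × Fin d) (fun b => h42 b.1 b.2) hB₀ h59a h59g h59j h59l hside h50
  -- `C₂(d, α₀) ≤ C₂(d)` on the window, so (1.60) holds with `C₂(d)`
  have hC := C2_le_of_window (d := d) hα₂ hsmall
  set R₀ := B₀ * (4 * α₀ + 4 * d * L * α₁ + 2 * α₂ ^ 2 + 20 * d * α₀ * α₂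
      + 2 * (8 * (131072 * ((d : ℝ) + 1) ^ 2) * Real.exp (4 * (800 * ((d : ℝ) + 1) ^ 2 * ((d : ℝ) + 4)) * α₀))
        * α₂ ^ 2) with hR₀
  set R₁ := B₀ * (4 * α₀ + 4 * d * L * α₁ + 2 * α₂ ^ 2 + 20 * d * α₀ * α₂
      + 2 * (2097152 * ((d : ℝ) + 1) ^ 2) * α₂ ^ 2) with hR₁
  have hR : R₀ ≤ R₁ := by
    rw [hR₀, hR₁]
    apply mul_le_mul_of_nonneg_left _ hB₀
    have hsq : 0 ≤ α₂ ^ 2 := sq_nonneg _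
    nlinarith [mul_le_mul_of_nonneg_right hC hsq]
  -- (1.60) + (1.61) ⇒ (1.62) (`B8.apriori_162`)
  have hdL : (1 : ℝ) ≤ (d : ℝ) * L := by
    have : (1 : ℝ) ≤ d := by exact_mod_cast hd
    nlinarith
  have h162 : R₁ ≤ 5 * d * L * B₀ * (α₀ + α₁) := by
    rw [hR₁]
    exact B8.apriori_162 hB₀ hdL hα₀.le hα₁ h61
  exact ⟨ha.trans (hR.trans h162), hg.trans (hR.trans h162), hj.trans (hR.trans h162), hl.trans (hR.trans h162)⟩

/-- **(1.62) AS PRINTED, POINTWISE** «|A| < 5dLB₀(α₀ + α₁)(Lʲη)⁻¹, |∇^η_{U₀}A| < 5dLB₀(α₀ + α₁)(Lʲη)⁻² … on Ω_j»: under the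
hypotheses of `prop3_norms_of_small`, at every bond `‖A y κ‖ ≤ 5dLB₀(α₀+α₁)(Lʲη)⁻¹` and every component of the forward
covariant gradient (1.1) obeys `‖(D^η_{U₀,κ}A_τ)(y)‖ ≤ 5dLB₀(α₀+α₁)(Lʲη)⁻²`; the third and fourth members for the carried
reals `j₂`, `l`. [cite: Balaban1985RegularSpaces, Prop. 3 (1.62) p.87] -/
theorem prop3_pointwise_of_small (hd : 1 ≤ d) {η : ℝ} (hη : 0 < η) {L : ℕ} (hL : 2 ≤ L) {j : ℕ}
    {U₀ : Site d → Fin d → 𝔸ˣ} (hU₀ : ∀ y κ, U₀ y κ ∈ unitaryUnits 𝔸)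
    {A : Site d → Fin d → 𝔸} (hAh : ∀ y κ, IsSelfAdjoint (A y κ)) {α₀ α₁ α₂ : ℝ}
    (hα₀ : 0 < α₀) (hα₁ : 0 ≤ α₁) (hα₂ : 0 ≤ α₂)
    (hα3 : C0 d * α₀ ≤ 1 / 3) (hα4 : 4 * α₀ ≤ c2' d L) (h16 : 16 * α₂ ≤ 1)
    (hsmall : Real.exp (4 * (800 * ((d : ℝ) + 1) ^ 2 * ((d : ℝ) + 4)) * α₀)
      * (1 + 8 * (131072 * ((d : ℝ) + 1) ^ 2) * α₂) ≤ 2)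
    (hc₃ : 2 * α₂ ≤ c3 d L) {B₀ : ℝ} (hB₀ : 0 ≤ B₀) (hside : 36 * d * B₀ * α₂ ≤ 1 / 2) (h50 : 50 * d * α₂ ≤ 1)
    (h61 : 2 * α₂ ^ 2 + 20 * d * α₀ * α₂ + 2 * (2097152 * ((d : ℝ) + 1) ^ 2) * α₂ ^ 2 ≤ α₀ + α₁)
    (h40 : pdev U₀ < α₀ * (((L : ℝ) ^ j)⁻¹) ^ 2)
    (h40₀ : ∀ (μ : Fin d) (x : Site d), ‖covDiv η U₀ μ x‖ ≤ α₀ * η ^ 2 * (((L : ℝ) ^ j * η)⁻¹) ^ 3)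
    (h40₁ : ∀ (μ : Fin d) (x : Site d),
      ‖covDiv η (mulCfg (expCfg (iEta η A)) U₀) μ x‖ ≤ α₀ * η ^ 2 * (((L : ℝ) ^ j * η)⁻¹) ^ 3)
    (h41 : ∀ y κ, ‖A y κ‖ ≤ α₂ * ((L : ℝ) ^ j * η)⁻¹)
    (S : Set (Site d × Fin d)) (h42 : ∀ b ∈ S, ‖logCovIter L U₀ (iEta η A) j b.1 b.2‖ < 2 * d * L * α₁)
    {j₂ l : ℝ}
    (h59a : wsup ((L : ℝ) ^ j * η) (fun p : Site d × Fin d => A p.1 p.2)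
      ≤ B₀ * (jNorm3 η L j U₀ A + wsup 1 (fun b : S => linCovIter L U₀ (iEta η A) j b.1.1 b.1.2)))
    (h59g : gradNorm2 η L j U₀ A
      ≤ B₀ * (jNorm3 η L j U₀ A + wsup 1 (fun b : S => linCovIter L U₀ (iEta η A) j b.1.1 b.1.2)))
    (h59j : j₂ ≤ B₀ * (jNorm3 η L j U₀ A + wsup 1 (fun b : S => linCovIter L U₀ (iEta η A) j b.1.1 b.1.2)))
    (h59l : l ≤ B₀ * (jNorm3 η L j U₀ A + wsup 1 (fun b : S => linCovIter L U₀ (iEta η A) j b.1.1 b.1.2))) :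
    (∀ y κ, ‖A y κ‖ ≤ 5 * d * L * B₀ * (α₀ + α₁) * ((L : ℝ) ^ j * η)⁻¹) ∧
    (∀ (y : Site d) (κ τ : Fin d),
      ‖covDerivFwd η U₀ κ (fun z => A z τ) y‖ ≤ 5 * d * L * B₀ * (α₀ + α₁) * (((L : ℝ) ^ j * η)⁻¹) ^ 2) ∧
    j₂ ≤ 5 * d * L * B₀ * (α₀ + α₁) ∧ l ≤ 5 * d * L * B₀ * (α₀ + α₁) := by
  obtain ⟨ha, hg, hj, hl⟩ := prop3_norms_of_small hd hη hL hU₀ hAh hα₀ hα₁ hα₂ hα3 hα4 h16 hsmall hc₃ hB₀ hside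
    h50 h61 h40 h40₀ h40₁ h41 S h42 h59a h59g h59j h59l
  have hL0 : 0 < L := lt_of_lt_of_le (by norm_num) hL
  set s : ℝ := (L : ℝ) ^ j * η with hs
  have hs0 : 0 < s := by positivity
  have h₀ : ∀ y κ, U₀ y κ ∈ U1 𝔸 := fun y κ => unitaryUnits_le_U1 (hU₀ y κ)
  refine ⟨fun y κ => ?_, fun y κ τ => ?_, hj, hl⟩
  · -- `|A|_(−1)` is a genuine supremum under (1.41): `(Lʲη)‖A y κ‖ ≤ |A|_(−1)`
    have hb : ∀ p : Site d × Fin d, s * ‖A p.1 p.2‖ ≤ α₂ := fun p => by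
      have h := mul_le_mul_of_nonneg_left (h41 p.1 p.2) hs0.le
      have e : s * (α₂ * s⁻¹) = α₂ := by field_simp
      exact h.trans_eq e
    have hy : s * ‖A y κ‖ ≤ 5 * d * L * B₀ * (α₀ + α₁) :=
      (le_wsup (F := fun p : Site d × Fin d => A p.1 p.2) hb (y, κ)).trans ha
    rw [← div_eq_mul_inv, le_div_iff₀ hs0]
    linarith
  · calc ‖covDerivFwd η U₀ κ (fun z => A z τ) y‖ ≤ (s⁻¹) ^ 2 * gradNorm2 η L j U₀ A :=
          norm_covDerivFwd_le_gradNorm2 hη h₀ h41 hL0 j y κ τ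
      _ ≤ (s⁻¹) ^ 2 * (5 * d * L * B₀ * (α₀ + α₁)) := mul_le_mul_of_nonneg_left hg (sq_nonneg _)
      _ = 5 * d * L * B₀ * (α₀ + α₁) * (s⁻¹) ^ 2 := mul_comm _ _

/-! ## §3 Proposition 3 in print's quantifier shape: the threshold `c(d, L, B₀)` -/

/-- **PROPOSITION 3** (p. 87) ON THE `ℤᵈ` CARRIERS, one level `j`: «α₀, α₁, α₂ bounded by a constant depending on d and L
only» made explicit as `c = c(d, L, B₀) > 0` (`B₀` «depends on d and L only»), namely
`c = min{1/(24C₀(d)), c₂′(d,L)/16, 1/(32000(d+1)²(d+4)), 1/(2097152(d+1)²), c₃(d,L)/2, 1/(80d), 1/(72d(B₀+1))}`; for all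
`0 < α₀, α₁, α₂ ≤ c` with (1.61) (`C₂ = C₂(d)`), every unitary-valued `U₀` and Hermitian `A` satisfying (1.40)–(1.42) at the
level `j` and the four (1.59) bounds of Theorem 3.3 of [4], the configuration `U₁ = e^{iηA}` satisfies (1.62) = (1.36)/(1.39)
with `B₁ = 5dLB₀`: in norm form `|A|_(−1), |∇^η_{U₀}A|_(−2), j₂, l ≤ 5dLB₀(α₀+α₁)` and pointwise
`‖A y κ‖ ≤ 5dLB₀(α₀+α₁)(Lʲη)⁻¹`, `‖(D^η_{U₀,κ}A_τ)(y)‖ ≤ 5dLB₀(α₀+α₁)(Lʲη)⁻²`. [cite: Balaban1985RegularSpaces, Prop. 3 p.87; (1.40)–(1.42) p.83; (1.59)–(1.62) pp.86–87] -/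
theorem prop3_concrete (hd : 1 ≤ d) {η : ℝ} (hη : 0 < η) {L : ℕ} (hL : 2 ≤ L) (j : ℕ) {B₀ : ℝ} (hB₀ : 0 ≤ B₀) :
    ∃ c : ℝ, 0 < c ∧ ∀ ⦃α₀ α₁ α₂ : ℝ⦄, 0 < α₀ → α₀ ≤ c → 0 < α₁ → α₁ ≤ c → 0 < α₂ → α₂ ≤ c →
      2 * α₂ ^ 2 + 20 * d * α₀ * α₂ + 2 * (2097152 * ((d : ℝ) + 1) ^ 2) * α₂ ^ 2 ≤ α₀ + α₁ →
      ∀ (U₀ : Site d → Fin d → 𝔸ˣ), (∀ y κ, U₀ y κ ∈ unitaryUnits 𝔸) →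
      ∀ (A : Site d → Fin d → 𝔸), (∀ y κ, IsSelfAdjoint (A y κ)) →
      pdev U₀ < α₀ * (((L : ℝ) ^ j)⁻¹) ^ 2 →
      (∀ (μ : Fin d) (x : Site d), ‖covDiv η U₀ μ x‖ ≤ α₀ * η ^ 2 * (((L : ℝ) ^ j * η)⁻¹) ^ 3) →
      (∀ (μ : Fin d) (x : Site d),
        ‖covDiv η (mulCfg (expCfg (iEta η A)) U₀) μ x‖ ≤ α₀ * η ^ 2 * (((L : ℝ) ^ j * η)⁻¹) ^ 3) →
      (∀ y κ, ‖A y κ‖ ≤ α₂ * ((L : ℝ) ^ j * η)⁻¹) →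
      ∀ (S : Set (Site d × Fin d)), (∀ b ∈ S, ‖logCovIter L U₀ (iEta η A) j b.1 b.2‖ < 2 * d * L * α₁) →
      ∀ ⦃j₂ l : ℝ⦄,
      wsup ((L : ℝ) ^ j * η) (fun p : Site d × Fin d => A p.1 p.2)
        ≤ B₀ * (jNorm3 η L j U₀ A + wsup 1 (fun b : S => linCovIter L U₀ (iEta η A) j b.1.1 b.1.2)) →
      gradNorm2 η L j U₀ A
        ≤ B₀ * (jNorm3 η L j U₀ A + wsup 1 (fun b : S => linCovIter L U₀ (iEta η A) j b.1.1 b.1.2)) →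
      j₂ ≤ B₀ * (jNorm3 η L j U₀ A + wsup 1 (fun b : S => linCovIter L U₀ (iEta η A) j b.1.1 b.1.2)) →
      l ≤ B₀ * (jNorm3 η L j U₀ A + wsup 1 (fun b : S => linCovIter L U₀ (iEta η A) j b.1.1 b.1.2)) →
      (wsup ((L : ℝ) ^ j * η) (fun p : Site d × Fin d => A p.1 p.2) ≤ 5 * d * L * B₀ * (α₀ + α₁) ∧
        gradNorm2 η L j U₀ A ≤ 5 * d * L * B₀ * (α₀ + α₁) ∧
        j₂ ≤ 5 * d * L * B₀ * (α₀ + α₁) ∧ l ≤ 5 * d * L * B₀ * (α₀ + α₁)) ∧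
      (∀ y κ, ‖A y κ‖ ≤ 5 * d * L * B₀ * (α₀ + α₁) * ((L : ℝ) ^ j * η)⁻¹) ∧
      (∀ (y : Site d) (κ τ : Fin d),
        ‖covDerivFwd η U₀ κ (fun z => A z τ) y‖ ≤ 5 * d * L * B₀ * (α₀ + α₁) * (((L : ℝ) ^ j * η)⁻¹) ^ 2) := by
  have hd' : (1 : ℝ) ≤ d := by exact_mod_cast hd
  have hd0 : (0 : ℝ) < d := by linarith
  have hL1 : 1 ≤ L := le_trans (by norm_num) hL
  have hC0 := C0_pos d
  have hc2 : 0 < c2' d L := B7Prop2Explicit.c2'_pos d L hL1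
  have hc3 : 0 < c3 d L := B7Prop3Flat.c3_pos d hL1
  refine ⟨min (1 / (24 * C0 d)) (min (c2' d L / 16) (min (1 / (32000 * ((d : ℝ) + 1) ^ 2 * ((d : ℝ) + 4)))
    (min (1 / (2097152 * ((d : ℝ) + 1) ^ 2)) (min (c3 d L / 2) (min (1 / (80 * (d : ℝ)))
    (1 / (72 * (d : ℝ) * (B₀ + 1)))))))), ?_, ?_⟩
  · refine lt_min (by positivity) (lt_min (by positivity) (lt_min (by positivity) (lt_min (by positivity)
      (lt_min (by positivity) (lt_min (by positivity) (by positivity))))))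
  intro α₀ α₁ α₂ hα₀ hα₀c hα₁ hα₁c hα₂ hα₂c h61 U₀ hU₀ A hAh h40 h40₀ h40₁ h41 S h42 j₂ l h59a h59g h59j h59l
  simp only [le_min_iff] at hα₀c hα₂c
  obtain ⟨h24₀, h16₀, h32₀, -, -, -, -⟩ := hα₀c
  obtain ⟨-, -, -, h21₂, hc3₂, h80₂, h72₂⟩ := hα₂c
  -- the windows
  have hα3 : C0 d * α₀ ≤ 1 / 3 := by
    have e : C0 d * (1 / (24 * C0 d)) = 1 / 24 := by field_simp
    have := (mul_le_mul_of_nonneg_left h24₀ hC0.le).trans_eq e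
    linarith
  have hα4 : 4 * α₀ ≤ c2' d L := by linarith
  have h80 : α₂ ≤ 1 / 80 := by
    have : (1 : ℝ) / (80 * d) ≤ 1 / 80 := by
      rw [div_le_div_iff₀ (by positivity) (by norm_num)]; nlinarith
    exact h80₂.trans this
  have h16 : 16 * α₂ ≤ 1 := by linarith
  have hdα : (d : ℝ) * α₂ ≤ 1 / 80 := by
    have := mul_le_mul_of_nonneg_left h80₂ hd0.le
    have e : (d : ℝ) * (1 / (80 * d)) = 1 / 80 := by field_simp
    linarith [this.trans_eq e]
  have h50 : 50 * d * α₂ ≤ 1 := by nlinarith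
  have hside : 36 * d * B₀ * α₂ ≤ 1 / 2 := by
    have h1 : 36 * d * B₀ * α₂ ≤ 36 * d * B₀ * (1 / (72 * (d : ℝ) * (B₀ + 1))) :=
      mul_le_mul_of_nonneg_left h72₂ (by positivity)
    have e : 36 * d * B₀ * (1 / (72 * (d : ℝ) * (B₀ + 1))) = B₀ / (2 * (B₀ + 1)) := by
      field_simp
      ring
    have h2 : B₀ / (2 * (B₀ + 1)) ≤ 1 / 2 := by
      rw [div_le_div_iff₀ (by positivity) (by norm_num)]; nlinarith
    linarith [h1.trans_eq e]
  have hsmall : Real.exp (4 * (800 * ((d : ℝ) + 1) ^ 2 * ((d : ℝ) + 4)) * α₀)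
      * (1 + 8 * (131072 * ((d : ℝ) + 1) ^ 2) * α₂) ≤ 2 := by
    have hx0 : 0 ≤ 4 * (800 * ((d : ℝ) + 1) ^ 2 * ((d : ℝ) + 4)) * α₀ := by positivity
    have hx : 4 * (800 * ((d : ℝ) + 1) ^ 2 * ((d : ℝ) + 4)) * α₀ ≤ 1 / 10 := by
      have h := mul_le_mul_of_nonneg_left h32₀ (by positivity : (0 : ℝ) ≤ 3200 * (((d : ℝ) + 1) ^ 2 * ((d : ℝ) + 4)))
      have e : (3200 * (((d : ℝ) + 1) ^ 2 * ((d : ℝ) + 4))) * (1 / (32000 * ((d : ℝ) + 1) ^ 2 * ((d : ℝ) + 4)))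
          = 1 / 10 := by
        field_simp; ring
      have e' : 4 * (800 * ((d : ℝ) + 1) ^ 2 * ((d : ℝ) + 4)) * α₀
          = (3200 * (((d : ℝ) + 1) ^ 2 * ((d : ℝ) + 4))) * α₀ := by ring
      rw [e']; exact h.trans_eq e
    have hy0 : 0 ≤ 8 * (131072 * ((d : ℝ) + 1) ^ 2) * α₂ := by positivity
    have hy : 8 * (131072 * ((d : ℝ) + 1) ^ 2) * α₂ ≤ 1 / 2 := by
      have h := mul_le_mul_of_nonneg_left h21₂ (by positivity : (0 : ℝ) ≤ 1048576 * ((d : ℝ) + 1) ^ 2)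
      have e : (1048576 * ((d : ℝ) + 1) ^ 2) * (1 / (2097152 * ((d : ℝ) + 1) ^ 2)) = 1 / 2 := by
        field_simp; ring
      have e' : 8 * (131072 * ((d : ℝ) + 1) ^ 2) * α₂ = (1048576 * ((d : ℝ) + 1) ^ 2) * α₂ := by ring
      rw [e']; exact h.trans_eq e
    exact exp_window hx0 hx hy0 hy
  have hc₃ : 2 * α₂ ≤ c3 d L := by linarith
  have hN := prop3_norms_of_small hd hη hL hU₀ hAh hα₀ hα₁.le hα₂.le hα3 hα4 h16 hsmall hc₃ hB₀ hside h50 h61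
    h40 h40₀ h40₁ h41 S h42 h59a h59g h59j h59l
  obtain ⟨hP1, hP2, -, -⟩ := prop3_pointwise_of_small hd hη hL hU₀ hAh hα₀ hα₁.le hα₂.le hα3 hα4 h16 hsmall hc₃
    hB₀ hside h50 h61 h40 h40₀ h40₁ h41 S h42 h59a h59g h59j h59l
  exact ⟨hN, hP1, hP2⟩

end Literature.MathematicalPhysics.QuantumFieldTheory.Balaban1983to89.B8Prop3Concrete
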